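import Mathlib
import Literature.NumberTheory.DiophantineGeometry.AbcShapeReductionCount

/-!
# drefute scratch: at `d = 2` the "reshape target" `ShapeLevelBound` *is* the lever `LevelTorsorBound`

The two `Prop`s are copied verbatim from `Cruxes/MazurKaneLaw/Lines/peyre-level-torsor-v22.lean`.
`shapeLevelBound_two_iff` : `ShapeLevelBound` specialised to `d = 2` is literally `LevelTorsorBound`
(empty level product = 1), hence `ShapeLevelBound → LevelTorsorBound`; with Stub B (`LevelTorsorBound →
ShapeLevelBound`) the two are EQUIVALENT, so the docstring's pre-authorised RESHAPE ("register `ShapeLevelBound`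
as the lever if a refuter kills the max-form f-pointwise") does not escape any f-pointwise counterexample:
a kill of A at `(f, X, Y, Z)` is a kill of `ShapeLevelBound` at `d = 2, c = f`.
-/

namespace DrefuteScratch

open scoped BigOperators
open Literature.NumberTheory.DiophantineGeometry
open Literature.NumberTheory.DiophantineGeometry.AbcShapes

def LevelTorsorBound : Prop :=
  ∀ ε : ℝ, 0 < ε → ∃ K : ℝ, ∀ (f₁ f₂ f₃ : ℕ) (X Y Z : Fin 2 → ℕ), 0 < f₁ → 0 < f₂ → 0 < f₃ →
    (∀ i, 0 < X i) → (∀ i, 0 < Y i) → (∀ i, 0 < Z i) →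
      (shapeCount f₁ f₂ f₃ X Y Z : ℝ) ≤
        K * ((f₃ : ℝ) * ((shapeVal Z : ℕ) : ℝ)) ^ ε *
          (1 + ((X 0 : ℝ) * X 1 * Y 0 * Y 1 * Z 0 * Z 1) / ((f₃ : ℝ) * ((shapeVal Z : ℕ) : ℝ)))

def ShapeLevelBound : Prop :=
  ∀ ε : ℝ, 0 < ε → ∀ d : ℕ, 2 ≤ d → ∃ K : ℝ, ∀ (c₁ c₂ c₃ : ℕ) (X Y Z : Fin d → ℕ),
    0 < c₁ → 0 < c₂ → 0 < c₃ → (∀ i, 0 < X i) → (∀ i, 0 < Y i) → (∀ i, 0 < Z i) →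
      (shapeCount c₁ c₂ c₃ X Y Z : ℝ) ≤
        K * ((c₃ : ℝ) * ((shapeVal Z : ℕ) : ℝ)) ^ ε *
          ((∏ i ∈ Finset.univ.filter (fun i : Fin d => 2 ≤ (i : ℕ)), ((X i : ℝ) * Y i * Z i)) +
            (∏ i, ((X i : ℝ) * Y i * Z i)) / ((c₃ : ℝ) * ((shapeVal Z : ℕ) : ℝ)))

theorem filter_two_le_fin_two : Finset.univ.filter (fun i : Fin 2 => 2 ≤ (i : ℕ)) = ∅ := by
  decide

/-- The `d = 2` instance of `ShapeLevelBound` is `LevelTorsorBound` on the nose. -/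
theorem levelTorsorBound_of_shapeLevelBound (h : ShapeLevelBound) : LevelTorsorBound := by
  intro ε hε
  obtain ⟨K, hK⟩ := h ε hε 2 le_rfl
  refine ⟨K, fun f₁ f₂ f₃ X Y Z h1 h2 h3 hX hY hZ => ?_⟩
  have h0 := hK f₁ f₂ f₃ X Y Z h1 h2 h3 hX hY hZ
  rw [filter_two_le_fin_two, Finset.prod_empty, Fin.prod_univ_two] at h0
  convert h0 using 3
  ring

end DrefuteScratch
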